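import Literature.Computability.MetaComplexity.ResLin
import HarnessLib

/-!
# Complexity meta: soundness of resolution over parities Res(⊕)

Proofs accompanying `Literature.Computability.MetaComplexity.ResLin`: the discharge
`not_satisfiable_of_isResLinRefutation_holds` of the named fact
`not_satisfiable_of_isResLinRefutation` (soundness of the proof system Res(⊕) of
Itsykson–Sokolov: a CNF with a Res(⊕) refutation is unsatisfiable), together with the
line-soundness lemma `IsResLinDerivation.eval_clause` it rests on.

## References

* D. Itsykson, D. Sokolov, *Resolution over linear equations modulo two*, Ann. Pure Appl.
  Logic 171 (2020) 102722, §2 (the system Res(⊕): resolution rule and semantic weakening rule,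
  refutations as derivations of the empty clause).
* D. Itsykson, D. Sokolov, *Lower bounds for splittings by linear combinations*, MFCS 2014,
  LNCS 8635; full version (author copy), §6 "Res-Lin", pp. 9–10.
-/

namespace Literature.Computability.MetaComplexity

open _root_.Computability Complexity

/-! ### The soundness theorem

Discharge of the named fact `not_satisfiable_of_isResLinRefutation`. Source: Itsykson–Sokolov,
*Resolution over linear equations modulo two*, Ann. Pure Appl. Logic 171 (2020) 102722, §2
(Res(⊕) as a proof system for unsatisfiable CNFs: the resolution rule
`C ∨ (f = 0), D ∨ (f = 1) ⊢ C ∨ D` and the semantic weakening rule; a refutation is a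
derivation of the empty clause); conference/full version: Itsykson–Sokolov, *Lower bounds for
splittings by linear combinations*, MFCS 2014, §6 "Res-Lin" (author copy, pp. 9–10: "The proof
of the unsatisfiability of a linear CNF is a derivation of the empty clause"). Soundness is the
fact that both rules preserve every satisfying assignment, so a refutable CNF has none. The
proof below is the line-by-line induction along the derivation: an `initial` line is a clause
of `φ` (faithfully translated, `eval_toLinClause`), a `resolve` line `C ∨ D` follows from
`C ∨ (f = 0)` and `D ∨ (f = 1)` because `f = 0` and `f = 1` are not both true under one
assignment, and a `weaken` line is implied by its premise by definition of the rule. -/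

/-- The equations `f = 0` and `f = 1` on the same linear form are not both true under `σ`.
[Itsykson–Sokolov 2020, §2 (resolution rule of Res(⊕))] [cite: ItsyksonSokolov2020, §2] -/
theorem LinLit.not_eval_false_and_true (σ : ℕ → Bool) (f : Finset ℕ)
    (h0 : LinLit.eval σ (f, false) = true) (h1 : LinLit.eval σ (f, true) = true) : False := by
  simp only [LinLit.eval, Bool.toNat_false, Bool.toNat_true, decide_eq_true_eq] at h0 h1
  omega

/-- The empty linear clause is false under every assignment. [Itsykson–Sokolov 2020, §2]
[cite: ItsyksonSokolov2020, §2] -/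
@[simp] theorem LinClause.eval_empty (σ : ℕ → Bool) : LinClause.eval σ ∅ = false := by
  simp [LinClause.eval]

/-- Soundness of the lines of a Res(⊕) derivation: every line of a derivation from `φ` is
satisfied by every assignment satisfying `φ` (induction along the derivation; the resolution
rule is sound because `f = 0` and `f = 1` exclude each other, the weakening rule is semantic).
[Itsykson–Sokolov 2020, §2 (soundness of Res(⊕))] [cite: ItsyksonSokolov2020, §2] -/
theorem IsResLinDerivation.eval_clause {φ : CNF ℕ} {π : List ResLinLine}
    (hπ : IsResLinDerivation φ π) {σ : ℕ → Bool} (hσ : φ.eval σ = true) :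
    ∀ k (hk : k < π.length), (π[k]'hk).clause.eval σ = true := by
  intro k
  induction k using Nat.strong_induction_on with
  | _ k ih =>
    intro hk
    have hv := hπ k hk
    have hlen : (π.take k).length = k := by simp [List.length_take, hk.le]
    rcases hr : (π[k]'hk).rule with _ | ⟨i, j, f⟩ | i
    · -- an initial clause of `φ`
      simp only [IsValidResLinLine, hr] at hv
      obtain ⟨c, hc, hcl⟩ := hv
      rw [hcl, eval_toLinClause]
      exact (CNF.eval_eq_true_iff φ σ).1 hσ c hc
    · -- a resolution step on the linear form `f`
      simp only [IsValidResLinLine, hr] at hv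
      obtain ⟨hi, hj, C, D, hC, hD, hcl⟩ := hv
      have hik : i < k := by omega
      have hjk : j < k := by omega
      simp only [List.getElem_take] at hC hD
      have h₁ := ih i hik (hik.trans hk)
      have h₂ := ih j hjk (hjk.trans hk)
      rw [hC] at h₁
      rw [hD] at h₂
      rw [hcl]
      simp only [LinClause.eval, decide_eq_true_eq, Finset.mem_insert, Finset.mem_union]
        at h₁ h₂ ⊢
      obtain ⟨l₁, rfl | hl₁, he₁⟩ := h₁
      · obtain ⟨l₂, rfl | hl₂, he₂⟩ := h₂
        · exact (LinLit.not_eval_false_and_true σ f he₁ he₂).elim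
        · exact ⟨l₂, Or.inr hl₂, he₂⟩
      · exact ⟨l₁, Or.inl hl₁, he₁⟩
    · -- a semantic weakening step
      simp only [IsValidResLinLine, hr] at hv
      obtain ⟨hi, himp⟩ := hv
      have hik : i < k := by omega
      refine himp σ ?_
      rw [List.getElem_take]
      exact ih i hik (hik.trans hk)

/-- Every line of a Res(⊕) derivation from `φ` is a semantic consequence of `φ`.
[Itsykson–Sokolov 2020, §2 (soundness of Res(⊕))] [cite: ItsyksonSokolov2020, §2] -/
theorem IsResLinDerivation.eval_clause_of_mem {φ : CNF ℕ} {π : List ResLinLine}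
    (hπ : IsResLinDerivation φ π) {σ : ℕ → Bool} (hσ : φ.eval σ = true) {l : ResLinLine}
    (hl : l ∈ π) : l.clause.eval σ = true := by
  obtain ⟨k, hk, rfl⟩ := List.getElem_of_mem hl
  exact hπ.eval_clause hσ k hk

/-- **Soundness of Res(⊕)** (discharge of `not_satisfiable_of_isResLinRefutation`): a CNF with
a Res(⊕) refutation is unsatisfiable, since every derived linear clause is satisfied by any
assignment satisfying the CNF while the empty linear clause is satisfied by none.
[Itsykson–Sokolov 2020, §2 (Res(⊕) is sound and complete)] [cite: ItsyksonSokolov2020, §2] -/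
theorem not_satisfiable_of_isResLinRefutation_holds : not_satisfiable_of_isResLinRefutation := by
  intro φ π h hsat
  obtain ⟨hder, l, hl, hempty⟩ := h
  obtain ⟨σ, hσ⟩ := hsat
  have := hder.eval_clause_of_mem hσ hl
  rw [hempty, LinClause.eval_empty] at this
  exact Bool.false_ne_true this

/-! ### Res(⊕) simulates resolution

[Itsykson–Sokolov 2020, §2; Krajíček 2019, §7.1.3 and Lemma 7.1.1 ("R(LIN) p-simulates R",
whose "first assertion is obvious")]: a clause is a linear clause whose equations have one
variable each (`x ↦ (x = 1)`, `¬x ↦ (x = 0)`), and the resolution rule on `x` is the Res(⊕)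
rule on the linear form `f = x`; so a resolution refutation is translated line by line into a
Res(⊕) refutation of the same length (an initial clause stays an initial clause, a weakening
step becomes a semantic weakening step). This discharges the named facts
`exists_isResLinRefutation_of_isResRefutation` and `minResLinRefutationSize_le` of
`Literature.Computability.MetaComplexity.ResLin` (both state the weaker bound "`+ |φ|` lines"). -/

/-- Validity of an `initial` line: its clause is (the translation of) a clause of `φ`.
[Itsykson–Sokolov 2020, §2 (clauses of the CNF as axioms)] [cite: ItsyksonSokolov2020, §2] -/
theorem IsValidResLinLine.of_initial {φ : CNF ℕ} {prev : List ResLinLine} {l : ResLinLine}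
    (hr : l.rule = .initial) {c : Clause ℕ} (hc : c ∈ φ)
    (hcl : l.clause = Clause.toLinClause c) : IsValidResLinLine φ prev l := by
  simp only [IsValidResLinLine, hr]
  exact ⟨c, hc, hcl⟩

/-- Validity of a `resolve i j f` line: earlier lines `i`, `j` are `C ∨ (f = 0)` and
`D ∨ (f = 1)` and the line is `C ∨ D`. [Itsykson–Sokolov 2020, §2 (resolution rule)]
[cite: ItsyksonSokolov2020, §2] -/
theorem IsValidResLinLine.of_resolve {φ : CNF ℕ} {prev : List ResLinLine} {l : ResLinLine}
    {i j : ℕ} {f : Finset ℕ} (hr : l.rule = .resolve i j f) (hi : i < prev.length)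
    (hj : j < prev.length) {C D : LinClause} (hC : (prev[i]'hi).clause = insert (f, false) C)
    (hD : (prev[j]'hj).clause = insert (f, true) D) (hcl : l.clause = C ∪ D) :
    IsValidResLinLine φ prev l := by
  simp only [IsValidResLinLine, hr]
  exact ⟨hi, hj, C, D, hC, hD, hcl⟩

/-- Validity of a `weaken i` line: it is semantically implied by earlier line `i`.
[Itsykson–Sokolov 2020, §2 (semantic weakening rule)] [cite: ItsyksonSokolov2020, §2] -/
theorem IsValidResLinLine.of_weaken {φ : CNF ℕ} {prev : List ResLinLine} {l : ResLinLine}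
    {i : ℕ} (hr : l.rule = .weaken i) (hi : i < prev.length)
    (himp : ∀ σ : ℕ → Bool, (prev[i]'hi).clause.eval σ = true → l.clause.eval σ = true) :
    IsValidResLinLine φ prev l := by
  simp only [IsValidResLinLine, hr]
  exact ⟨hi, himp⟩

/-- The translation of a set-clause of `φ` is the linear clause of the corresponding clause
of `φ`. [Itsykson–Sokolov 2020, §2 (clauses of a CNF as linear clauses)]
[cite: ItsyksonSokolov2020, §2] -/
theorem image_toLinLit_toFinset (c : Clause ℕ) :
    c.toFinset.image Literal.toLinLit = Clause.toLinClause c := by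
  ext x
  simp [Clause.toLinClause]

/-- Semantic weakening is implied by containment of linear clauses.
[Itsykson–Sokolov 2020, §2 (weakening rule)] [cite: ItsyksonSokolov2020, §2] -/
theorem LinClause.eval_mono {C D : LinClause} (h : C ⊆ D) {σ : ℕ → Bool}
    (hC : C.eval σ = true) : D.eval σ = true := by
  simp only [LinClause.eval, decide_eq_true_eq] at hC ⊢
  obtain ⟨x, hx, hxσ⟩ := hC
  exact ⟨x, h hx, hxσ⟩

/-- One step of the simulation, for any line translation `T` that translates clauses
literal-wise and rules as `initial ↦ initial`, `resolve i j v ↦ resolve j i xᵥ` (Res(⊕) lists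
the premise containing `xᵥ = 0` first), `weaken i ↦ weaken i`: a valid resolution line
translates into a valid Res(⊕) line over the translated earlier lines.
[Itsykson–Sokolov 2020, §2 (Res(⊕) simulates resolution); Krajíček 2019, Lemma 7.1.1]
[cite: ItsyksonSokolov2020, §2] [cite: KrajicekProofComplexity2019, Lemma 7.1.1] -/
theorem IsValidResLine.map_resLin {φ : CNF ℕ} {prev : List (ResLine ℕ)} {l : ResLine ℕ}
    (h : IsValidResLine φ prev l) (T : ResLine ℕ → ResLinLine)
    (hTc : ∀ l, (T l).clause = l.clause.image Literal.toLinLit)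
    (hTi : ∀ C, (T ⟨C, .initial⟩).rule = .initial)
    (hTr : ∀ C i j v, (T ⟨C, .resolve i j v⟩).rule = .resolve j i {v})
    (hTw : ∀ C i, (T ⟨C, .weaken i⟩).rule = .weaken i) :
    IsValidResLinLine φ (prev.map T) (T l) := by
  obtain ⟨C, r⟩ := l
  cases r with
  | initial =>
    obtain ⟨c, hc, rfl⟩ : ∃ c ∈ φ, c.toFinset = C := by
      simpa [IsValidResLine, CNF.clauseFinsets] using h
    exact IsValidResLinLine.of_initial (hTi _) hc (by rw [hTc, image_toLinLit_toFinset])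
  | resolve i j v =>
    obtain ⟨hi, hj, hv, hnv, rfl⟩ :
        ∃ hi : i < prev.length, ∃ hj : j < prev.length,
          IsResolvent (prev[i]'hi).clause (prev[j]'hj).clause v C := h
    refine IsValidResLinLine.of_resolve (hTr _ _ _ _) (by simpa using hj) (by simpa using hi)
      (C := ((prev[j]'hj).clause.erase (v, false)).image Literal.toLinLit)
      (D := ((prev[i]'hi).clause.erase (v, true)).image Literal.toLinLit) ?_ ?_ ?_
    · rw [List.getElem_map, hTc]
      conv_lhs => rw [← Finset.insert_erase hnv, Finset.image_insert]
      rfl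
    · rw [List.getElem_map, hTc]
      conv_lhs => rw [← Finset.insert_erase hv, Finset.image_insert]
      rfl
    · rw [hTc, Finset.image_union, Finset.union_comm]
  | weaken i =>
    obtain ⟨hi, hsub⟩ : ∃ hi : i < prev.length, (prev[i]'hi).clause ⊆ C := h
    refine IsValidResLinLine.of_weaken (hTw _ _) (by simpa using hi) fun σ hσ => ?_
    rw [List.getElem_map, hTc] at hσ
    rw [hTc]
    exact LinClause.eval_mono (Finset.image_subset_image hsub) hσ

/-- The simulation along a whole derivation, for a line translation `T` as in
`IsValidResLine.map_resLin`: the translated list is a Res(⊕) derivation.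
[Itsykson–Sokolov 2020, §2 (Res(⊕) simulates resolution); Krajíček 2019, Lemma 7.1.1]
[cite: ItsyksonSokolov2020, §2] [cite: KrajicekProofComplexity2019, Lemma 7.1.1] -/
theorem IsResDerivation.map_resLin {φ : CNF ℕ} {π : List (ResLine ℕ)}
    (h : IsResDerivation φ π) (T : ResLine ℕ → ResLinLine)
    (hTc : ∀ l, (T l).clause = l.clause.image Literal.toLinLit)
    (hTi : ∀ C, (T ⟨C, .initial⟩).rule = .initial)
    (hTr : ∀ C i j v, (T ⟨C, .resolve i j v⟩).rule = .resolve j i {v})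
    (hTw : ∀ C i, (T ⟨C, .weaken i⟩).rule = .weaken i) :
    IsResLinDerivation φ (π.map T) := by
  intro k hk
  have hk' : k < π.length := by simpa using hk
  rw [← List.map_take, List.getElem_map]
  exact (h k hk').map_resLin T hTc hTi hTr hTw

/-- **Res(⊕) simulates resolution** line by line: a resolution refutation of `φ` yields a
Res(⊕) refutation of `φ` with the same number of lines, whose clauses are the literal-wise
translations of the original clauses. [Itsykson–Sokolov 2020, §2 (Res(⊕) simulates
resolution); Krajíček 2019, Lemma 7.1.1 (R(LIN) p-simulates R)] [cite: ItsyksonSokolov2020, §2]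
[cite: KrajicekProofComplexity2019, Lemma 7.1.1] -/
theorem IsResRefutation.exists_isResLinRefutation {φ : CNF ℕ} {π : List (ResLine ℕ)}
    (h : IsResRefutation φ π) :
    ∃ π' : List ResLinLine, IsResLinRefutation φ π' ∧
      π'.map ResLinLine.clause = π.map fun l => l.clause.image Literal.toLinLit := by
  -- the line-by-line translation
  refine ⟨π.map fun l => ⟨l.clause.image Literal.toLinLit,
      match l.rule with
      | .initial => .initial
      | .resolve i j v => .resolve j i {v}
      | .weaken i => .weaken i⟩, ⟨?_, ?_⟩, ?_⟩
  · exact h.1.map_resLin _ (fun _ => rfl) (fun _ => rfl) (fun _ _ _ _ => rfl) (fun _ _ => rfl)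
  · obtain ⟨l, hl, hl0⟩ := h.2
    exact ⟨_, List.mem_map.2 ⟨l, hl, rfl⟩, by simp [hl0]⟩
  · simp

/-- Res(⊕) simulates resolution with no increase in the number of lines, discharging
`exists_isResLinRefutation_of_isResRefutation` (which states the weaker bound `|π| + |φ|`).
[Itsykson–Sokolov 2020, §2 (Res(⊕) simulates resolution); Krajíček 2019, Lemma 7.1.1]
[cite: ItsyksonSokolov2020, §2] [cite: KrajicekProofComplexity2019, Lemma 7.1.1] -/
theorem exists_isResLinRefutation_of_isResRefutation_holds :
    exists_isResLinRefutation_of_isResRefutation := by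
  intro φ π h
  obtain ⟨π', hπ', hcl⟩ := h.exists_isResLinRefutation
  have hlen : π'.length = π.length := by simpa using congrArg List.length hcl
  exact ⟨π', hπ', by omega⟩

/-- The minimal Res(⊕) refutation size is at most the minimal resolution refutation size.
[Itsykson–Sokolov 2020, §2 (Res(⊕) simulates resolution); Krajíček 2019, Lemma 7.1.1]
[cite: ItsyksonSokolov2020, §2] [cite: KrajicekProofComplexity2019, Lemma 7.1.1] -/
theorem minResLinRefutationSize_le_minResRefutationSize (φ : CNF ℕ) :
    minResLinRefutationSize φ ≤ minResRefutationSize φ := by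
  refine le_iInf₂ fun π hπ => ?_
  obtain ⟨π', hπ', hcl⟩ := hπ.exists_isResLinRefutation
  have hlen : π'.length = π.length := by simpa using congrArg List.length hcl
  exact (minResLinRefutationSize_le_length hπ').trans (by rw [hlen])

/-- Discharge of `minResLinRefutationSize_le`: Res(⊕) refutations are at most `|φ|` lines
longer than resolution refutations (in fact no longer at all,
`minResLinRefutationSize_le_minResRefutationSize`).
[Itsykson–Sokolov 2020, §2 (Res(⊕) simulates resolution); Krajíček 2019, Lemma 7.1.1]
[cite: ItsyksonSokolov2020, §2] [cite: KrajicekProofComplexity2019, Lemma 7.1.1] -/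
theorem minResLinRefutationSize_le_holds : minResLinRefutationSize_le :=
  fun φ => (minResLinRefutationSize_le_minResRefutationSize φ).trans le_self_add

end Literature.Computability.MetaComplexity
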